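/-
Copyright: cell pub-balaban-gaps (YM BLITZ Y1, track G1), seat g1-p2 GEN 12 (unit `pub-balaban-gaps-g1-p2`).  Row (D4) NODE O,
MODEL level on 59b–66's carrier — ROAD (c′) of g1-plan-1 GEN 39 ([G1-PLAN1-G39-PRECISION-110], skeleton #26), VALUE-LEVEL END:
the one-scale covariant propagator `(Δ_W + m² + a_KP_K(U))⁻¹` of a field `U` is a block walk expansion GLUED by (3.87)–(3.90) from
WHOLE-TORUS local inverses `A′_□⁻¹` read in per-cube gauges `ĝ_□` — the local data agreeing with `U^{ĝ_□}` on what the columns over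
`supp h_□` read (124), each `A′_□⁻¹` a block walk expansion with `covDop` letters (66 ∕ 126 for the χ-truncated gauge-fixed fields),
the step `[h_□⊗1, A′_□]A′_□⁻¹` small by (3.88)'s first-order shape (125 ∕ 128) — with NO sub-domain, NO Dirichlet propagator, NO
compression, and no constant depending on `K` or the volume.  HONEST FRAMING: the local data, gauges, cutoff partition, its overlap
letter and the per-cube expansions are HYPOTHESIS DATA (126 + 107 + 118 supply them for `Ũ^□ = e^{χ_□X^{(□)}}`); the two units are
hypotheses as in 56; derivative letters of the glued expansion are NOT claimed here ((ψ5): they want the covariant family at `U`);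
nothing of Bałaban's `Δ^{(k)}(𝐔)` is constructed; words of row (D4) UNCHANGED (`ExistsUniformAcrossSmall` + `TermDomination`, OBJECT
level); (D4) instance 0∕1; NOT BetaPertH, NOT continuum, NOT Clay.
-/
import Summits.QuantumFields.BalabanUV.Gaps.D4WalkBlockSeedTerms
import Summits.QuantumFields.BalabanUV.Gaps.D4WalkBlockSeedShapes
import Summits.QuantumFields.BalabanUV.Gaps.D4WalkBlockPartitionSum

/-!
# `Gaps.D4WalkBlockTruncatedSeeds` — (3.87)–(3.90) with whole-torus seeds in per-cube gauges: the one-scale covariant propagator is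
# a block walk expansion glued from local ones (cell pub-balaban-gaps, seat g1-p2 gen 12)

HONEST DEPENDENCY (cell pub-balaban, verbatim): continuum YM on T⁴ ⇐ BetaPertH ∧ nine spine estimates (0/9 proved);
BetaPertH ⇐ (D1) ∧ (D4) ∧ CAP+tail.

[B9] (3.87) `G′₀ = Σ_□ h_□G′_□h_□`, (3.88) `Δ′G′₀ = I − R′`, (3.89) `K(h_□)G′_□h_□ = O(M⁻¹)`, (3.90) `G′ = G′₀(I − R′)⁻¹`, Cor. 3.6 p. 408,
p. 410.  ROAD (c′): `G′_□ := fibD ĝ_□⁻¹·A′_□⁻¹·fibD ĝ_□` with `A′_□` the operator of a WHOLE-torus field agreeing with `U^{ĝ_□}` near `supp h_□`.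
* §1 `covB_nonneg`, `conj_rows_vanish`;
* §2 **`seed_blockWalkExpansion`**: `S = Σ_□ fibD(h_□ĝ_□⁻¹)·A′_□⁻¹·fibD(h_□ĝ_□)` is a block walk expansion (126 ∕ 66-type data → 90
  `BlockWalkExpansion.conj` → 127 `blockWalkExpansion_sum_localized`), constant `N·r_g²·K̄`;
* §3 **`step_blockWalkExpansion`**: `R = Σ_□ fibD ĝ_□⁻¹·([h_□⊗1, A′_□]A′_□⁻¹)·fibD(h_□ĝ_□)` is a block walk expansion with constant
  `N·r_g²·θ·K̄`, `θ ≥ Σ_μ (1 + ηβ)δ₁(covB_{inl μ} + covB_{inr μ}) + d(Λ + 2δ₁β) + |a_K|ωπ` (128's letter: print's `O(M⁻¹)`, K-free);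
* §4 **`blockWalkExpansion_covOp_glued`** — THE END: under 55's margin `c_μ(c_μ·1·(1·N r_g²θK̄)c_μ)c_μ < 1` («M large»), the two units,
  and 124's agreement hypotheses, `u ↦ (Δ_W(u) + m² + a_KP_K(U)(u))⁻¹` is a block walk expansion at `(ε − 2μ, κ − 2μ, ρ − 2μ)` with
  dominating distances — kernel identified by `covOp_resummation_shapes` + `inv_eq_of_resummation`.
WHAT IT IS NOT.  Derivative letters of the glued expansion in the covariant currency ((ψ5)); the construction of `χ_□`, `h_□`, `ĝ_□` and
their letters (`δ₁ = O(M⁻¹)`, `N`, `r_g`); OBJECT level (Bałaban's `Δ^{(k)}(𝐔)`, `𝓣_Bałaban`, `TermDomination`) untouched.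

References: T. Bałaban, Comm. Math. Phys. **99** (1985) 389–434 [B9], (3.8) p. 392, (3.35)–(3.37) p. 396, (3.50) p. 400, Cor. 3.5
p. 407, Cor. 3.6 p. 408, (3.87)–(3.90) p. 409, p. 410, (3.107)–(3.108) p. 416; Comm. Math. Phys. **116** (1988) [II], (1.11) p. 5, p. 15.
-/

noncomputable section

namespace Summit.QuantumFields.BalabanUV.Gaps.D4WalkBlockTruncatedSeeds

open Metric Set Finset
open scoped Matrix
open Literature.MathematicalPhysics.QuantumFieldTheory.Balaban1983to89
open Literature.MathematicalPhysics.QuantumFieldTheory.Balaban1983to89.B9SectDWalk (DomBy)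
open Literature.MathematicalPhysics.QuantumFieldTheory.Balaban1983to89.B9Thm34Ext (toB6)
open Literature.MathematicalPhysics.QuantumFieldTheory.Balaban1983to89.B9Thm37GlueTorus (torusGeom tdist1)
open Literature.MathematicalPhysics.QuantumFieldTheory.Balaban1983to89.TreeLengthTorus (TPt)
open Literature.MathematicalPhysics.QuantumFieldTheory.Balaban1983to89.B5TorusCover (UT)
open Literature.MathematicalPhysics.QuantumFieldTheory.Balaban1983to89.B11SectG (RowSum)
open Literature.MathematicalPhysics.QuantumFieldTheory.Balaban1983to89.B5Ineq137Torus (Nv blk)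
open Summit.QuantumFields.BalabanUV.Gaps.D4WalkBlock (blockNorm BlockWalkExpansion)
open Summit.QuantumFields.BalabanUV.Gaps.D4WalkBlockDerivative (blockWalkExpansion_perturb)
open Summit.QuantumFields.BalabanUV.Gaps.D4WalkBlockFlatLetters (cubeOf cubeOf_eq_iff)
open Summit.QuantumFields.BalabanUV.Gaps.D4WalkBlockShiftAlgebra (fibD)
open Summit.QuantumFields.BalabanUV.Gaps.D4WalkBlockShiftWeighted (wOp)
open Summit.QuantumFields.BalabanUV.Gaps.D4WalkBlockCovariantShift (covDop covB)
open Summit.QuantumFields.BalabanUV.Gaps.D4WalkBlockCovariantPropagator (covOp)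
open Summit.QuantumFields.BalabanUV.Gaps.D4WalkBlockCovariantBlockAveraging (PU)
open Summit.QuantumFields.BalabanUV.Gaps.D4WalkBlockSeedResummation (wOp_commutator_apply inv_eq_of_resummation)
open Summit.QuantumFields.BalabanUV.Gaps.D4WalkBlockSeedTerms
  (commutator_row_eq_zero fibD_offCube PU_blockLocal blockNorm_commutator_covOp_mul_le)
open Summit.QuantumFields.BalabanUV.Gaps.D4WalkBlockSeedShapes
  (fibD_mul_apply_of_zero mul_fibD_apply_of_zero rowSum_fibD_smul_le covOp_resummation_shapes)
open Summit.QuantumFields.BalabanUV.Gaps.D4WalkBlockPartitionSum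
  (blockNorm_eq_zero_of_rows blockNorm_eq_zero_of_cols blockWalkExpansion_sum_localized domBy_sum_localized)

variable {P : Params} {F : Type} [Fintype F] [DecidableEq F]
variable {dd N' : ℕ} {E : Type*} [NormedAddCommGroup E] [NormedSpace ℂ E]
variable {B : Type} [Fintype B] [DecidableEq B]

/-! ## §1. Two small lemmas -/

omit [Fintype F] [DecidableEq F] in
/-- the relative `covDop` letters are non-negative. -/
theorem covB_nonneg (δ₀ : ℝ) (ι : Fin P.d ⊕ Fin P.d) : 0 ≤ covB P δ₀ ι := by
  cases ι with
  | inl μ => exact zero_le_one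
  | inr μ => exact (Real.exp_pos _).le

omit [DecidableEq F] in
/-- if the rows of `V` at site `x` vanish, so do the rows at site `x` of `fibD g⁻¹·(V·M)·G′`. ([folklore]) -/
theorem conj_rows_vanish (gi : Site P 0 → Matrix F F ℂ) (V M G' : Matrix (Site P 0 × F) (Site P 0 × F) ℂ) (x : Site P 0)
    (hV : ∀ a' r, V (x, a') r = 0) (a : F) (j : Site P 0 × F) : (fibD (Site P 0) F gi * (V * M) * G') (x, a) j = 0 := by
  rw [Matrix.mul_apply]
  refine Finset.sum_eq_zero fun k _ => ?_
  have h0 : (fibD (Site P 0) F gi * (V * M)) (x, a) k = 0 := by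
    rw [Matrix.mul_apply]
    refine Finset.sum_eq_zero fun m _ => ?_
    unfold fibD
    rw [Matrix.of_apply]
    split_ifs with h1
    · have hm : (V * M) m k = 0 := by
        rw [Matrix.mul_apply]
        refine Finset.sum_eq_zero fun r _ => ?_
        have : V m r = 0 := by
          have e : m = (x, m.2) := Prod.ext h1.symm rfl
          rw [e]; exact hV m.2 r
        rw [this, zero_mul]
      rw [hm, mul_zero]
    · rw [zero_mul]
  rw [h0, zero_mul]

/-! ## §2. The seed `S = Σ_□ fibD(h_□ĝ_□⁻¹)·A′_□⁻¹·fibD(h_□ĝ_□)` -/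

section Seed
variable {c₀ : B13.Consts} {X : Finset (UT (Nv P P.K))} {R ε κ Kbar ρ : ℝ}
variable {W : B → Type} {T : (b : B) → W b → (TPt dd N' → ℂ) → E → Matrix (Site P 0 × F) (Site P 0 × F) ℂ}
variable {SX : (b : B) → Set (W b)} {A : (b : B) → W b → ℝ} {D : (b : B) → W b → UT (Nv P P.K) → UT (Nv P P.K) → ℝ}
variable {pen : B → UT (Nv P P.K) → ℝ} {N rg : ℝ}
variable {Aloc : B → E → Matrix (Site P 0 × F) (Site P 0 × F) ℂ} {g gi : B → Site P 0 → Matrix F F ℂ} {h : B → Site P 0 → ℝ}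

/-- **THE SEED (3.87) IS A BLOCK WALK EXPANSION.**  Per-cube local inverses `A′_b⁻¹` block-walk-expanded at common `(ε, κ, K̄, ρ)`,
`ε ≤ ρ`; gauges with fibre row sums `≤ r_g`; a partition `|h_b| ≤ 1` supported in the cubes where `pen_b = 0`; overlap letter `N` ⟹
`S(u) = Σ_b fibD(h_bg_b⁻¹)·A′_b(u)⁻¹·fibD(h_bg_b)` is a block walk expansion at `(ε, κ, N·r_g²K̄, ρ)` with distances `D + pen`.
[cite: Balaban1985BackgroundPropagators, (3.87) p.409, Cor. 3.6 p.408, (3.108) p.416; Balaban1988RG2Cluster, (1.11) p.5, p.15] -/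
theorem seed_blockWalkExpansion
    (hG : ∀ b, BlockWalkExpansion c₀ (fun q : Site P 0 × F => cubeOf P q.1) (fun q => cubeOf P q.1)
      (fun (_ : TPt dd N' → ℂ) u => (Aloc b u)⁻¹) X R ε κ Kbar (T b) (SX b) (A b) (D b) ρ)
    (hερ : ε ≤ ρ) (hKbar : 0 ≤ Kbar) (hrg : 0 ≤ rg)
    (hgr : ∀ b x a', ∑ b', ‖g b x a' b'‖ ≤ rg) (hgir : ∀ b x a', ∑ b', ‖gi b x a' b'‖ ≤ rg) (hh1 : ∀ b x, |h b x| ≤ 1)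
    (hpen0 : ∀ b y, 0 ≤ pen b y) (hpenh : ∀ b x, pen b (cubeOf P x) ≠ 0 → h b x = 0)
    (hN : ∀ a, ∑ b, Real.exp (-((ρ - ε) * pen b a)) ≤ N) :
    BlockWalkExpansion c₀ (fun q : Site P 0 × F => cubeOf P q.1) (fun q => cubeOf P q.1)
      (fun (_ : TPt dd N' → ℂ) u => ∑ b, fibD (Site P 0) F (fun x => (((h b x : ℝ) : ℂ)) • gi b x) * (Aloc b u)⁻¹ *
        fibD (Site P 0) F (fun x => (((h b x : ℝ) : ℂ)) • g b x)) X R ε κ (N * (rg * rg * Kbar))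
      (fun (x : Σ b, W b) σ u => fibD (Site P 0) F (fun y => (((h x.1 y : ℝ) : ℂ)) • gi x.1 y) * T x.1 x.2 σ u *
        fibD (Site P 0) F (fun y => (((h x.1 y : ℝ) : ℂ)) • g x.1 y)) {x | x.2 ∈ SX x.1} (fun x => rg * rg * A x.1 x.2)
      (fun x y y' => D x.1 x.2 y y' + pen x.1 y + pen x.1 y') ρ := by
  have hconj : ∀ b, BlockWalkExpansion c₀ (fun q : Site P 0 × F => cubeOf P q.1) (fun q => cubeOf P q.1)
      (fun (σ : TPt dd N' → ℂ) u => fibD (Site P 0) F (fun x => (((h b x : ℝ) : ℂ)) • gi b x) *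
        (fun (_ : TPt dd N' → ℂ) u => (Aloc b u)⁻¹) σ u * fibD (Site P 0) F (fun x => (((h b x : ℝ) : ℂ)) • g b x)) X R ε κ
      (rg * rg * Kbar) (fun ω σ u => fibD (Site P 0) F (fun x => (((h b x : ℝ) : ℂ)) • gi b x) * T b ω σ u *
        fibD (Site P 0) F (fun x => (((h b x : ℝ) : ℂ)) • g b x)) (SX b) (fun ω => rg * rg * A b ω) (D b) ρ := fun b =>
    (hG b).conj _ _ (fun i j hne => fibD_offCube P F _ i j hne) (fun i j hne => fibD_offCube P F _ i j hne) hrg hrg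
      (rowSum_fibD_smul_le F (h b) (gi b) (hh1 b) (hgir b)) (rowSum_fibD_smul_le F (h b) (g b) (hh1 b) (hgr b))
  have hzero : ∀ b x, pen b (cubeOf P x) ≠ 0 → (fun y => (((h b y : ℝ) : ℂ)) • gi b y) x = 0 ∧
      (fun y => (((h b y : ℝ) : ℂ)) • g b y) x = 0 := fun b x hp => by
    simp only [hpenh b x hp, Complex.ofReal_zero, zero_smul, and_self]
  refine blockWalkExpansion_sum_localized hconj hερ (by positivity) hpen0 (fun b ω σ _ u _ y y' hne => ?_) hN
  constructor
  · by_contra hp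
    refine hne (blockNorm_eq_zero_of_rows _ _ _ (fun i hi j => ?_) y')
    have hx : pen b (cubeOf P i.1) ≠ 0 := by rw [show cubeOf P i.1 = y from hi]; exact hp
    rw [Matrix.mul_apply]
    exact Finset.sum_eq_zero fun k _ => by rw [fibD_mul_apply_of_zero F _ _ i (hzero b i.1 hx).1 k, zero_mul]
  · by_contra hp
    refine hne (blockNorm_eq_zero_of_cols _ _ _ (fun j hj i => ?_) y)
    have hx : pen b (cubeOf P j.1) ≠ 0 := by rw [show cubeOf P j.1 = y' from hj]; exact hp
    exact mul_fibD_apply_of_zero F _ _ j (hzero b j.1 hx).2 i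

end Seed

/-! ## §3. The step `R = Σ_□ fibD ĝ_□⁻¹·([h_□⊗1, A′_□]A′_□⁻¹)·fibD(h_□ĝ_□)` -/

section Step
variable {c₀ : B13.Consts} {X : Finset (UT (Nv P P.K))} {R ε κ Kbar ρ δ₀ : ℝ}
variable {W : B → Type} {T : (b : B) → W b → (TPt dd N' → ℂ) → E → Matrix (Site P 0 × F) (Site P 0 × F) ℂ}
variable {SX : (b : B) → Set (W b)} {A : (b : B) → W b → ℝ} {D : (b : B) → W b → UT (Nv P P.K) → UT (Nv P P.K) → ℝ}
variable {pen : B → UT (Nv P P.K) → ℝ} {N rg : ℝ}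
variable {Wpl Wml : B → Fin P.d → E → Site P 0 → Matrix F F ℂ} {PUl : B → E → Matrix (Site P 0 × F) (Site P 0 × F) ℂ}
variable {a msq : ℝ} {g gi : B → Site P 0 → Matrix F F ℂ} {h : B → Site P 0 → ℝ}
variable {δ₁ Λ β ω π θ : ℝ}

/-- **THE STEP (3.88)–(3.89) IS A BLOCK WALK EXPANSION WITH A K-FREE `O(∇h)` CONSTANT.**  Data as in §2 with `A′_b =
Δ_{W̃_b} + m² + a_KP̃_b` (entrywise holomorphic), the per-cube expansions' relative `covDop` letters `covB δ₀`, the partition's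
difference letters `|∇^±h_b| ≤ δ₁`, `|Δ^ηh_b| ≤ Λ`, its block oscillation `ω`, `h_b` and its lattice neighbours vanishing on the cubes
where `pen_b ≠ 0`, windows `Σ_{b′}‖W̃^±_{b,μ}(u,x)_{ab′}‖ ≤ ηβ`, averaging kernels living in the unit blocks with rows `≤ π`, and
`θ ≥ Σ_μ (1 + ηβ)δ₁(covB_{inl μ} + covB_{inr μ}) + d(Λ + 2δ₁β) + |a_K|ωπ` ⟹ `R(u) = Σ_b fibD g_b⁻¹·([h_b⊗1, A′_b(u)]A′_b(u)⁻¹)·fibD(h_bg_b)`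
is a block walk expansion at `(ε, κ, N·r_g²θK̄, ρ)` with distances `D + pen`. [cite: Balaban1985BackgroundPropagators, (3.88)–(3.89) p.409, Cor. 3.6 p.408, (3.108) p.416; Balaban1988RG2Cluster, (1.11) p.5, p.15] -/
theorem step_blockWalkExpansion
    (hG : ∀ b, BlockWalkExpansion c₀ (fun q : Site P 0 × F => cubeOf P q.1) (fun q => cubeOf P q.1)
      (fun (_ : TPt dd N' → ℂ) u => (covOp P F (Wpl b) (Wml b) (PUl b) a msq u)⁻¹) X R ε κ Kbar (T b) (SX b) (A b) (D b) ρ)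
    (hGD : ∀ b ι ω (σ : TPt dd N' → ℂ), (∀ j, ‖σ j‖ ≤ Real.exp c₀.κ₁) → ∀ u ∈ ball (0 : E) R, ∀ y y',
      blockNorm (fun q : Site P 0 × F => cubeOf P q.1) (fun q => cubeOf P q.1) (covDop P F ι * T b ω σ u) y y' ≤
        covB P δ₀ ι * (A b ω * Real.exp (-(ρ * D b ω y y'))))
    (hερ : ε ≤ ρ) (hKbar : 0 ≤ Kbar) (hrg : 0 ≤ rg)
    (hgr : ∀ b x a', ∑ b', ‖g b x a' b'‖ ≤ rg) (hgir : ∀ b x a', ∑ b', ‖gi b x a' b'‖ ≤ rg) (hh1 : ∀ b x, |h b x| ≤ 1)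
    (hpen0 : ∀ b y, 0 ≤ pen b y) (hpenh : ∀ b x, pen b (cubeOf P x) ≠ 0 → h b x = 0)
    (hpenN : ∀ b x μ, pen b (cubeOf P x) ≠ 0 → h b (Site.shift x μ) = 0 ∧ h b (Site.unshift x μ) = 0)
    (hN : ∀ a, ∑ b, Real.exp (-((ρ - ε) * pen b a)) ≤ N)
    (hAhol : ∀ b p q, DifferentiableOn ℂ (fun u => covOp P F (Wpl b) (Wml b) (PUl b) a msq u p q) (ball (0 : E) R))
    (hδ₁ : 0 ≤ δ₁) (hΛ : 0 ≤ Λ) (hβ : 0 ≤ β) (hω : 0 ≤ ω) (hπ : 0 ≤ π)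
    (hdp : ∀ b μ y, |P.eps⁻¹ * (h b (Site.shift y μ) - h b y)| ≤ δ₁)
    (hdm : ∀ b μ y, |P.eps⁻¹ * (h b y - h b (Site.unshift y μ))| ≤ δ₁)
    (hlap : ∀ b μ y, |(P.eps⁻¹) ^ 2 * (h b (Site.shift y μ) - 2 * h b y + h b (Site.unshift y μ))| ≤ Λ)
    (hWpl : ∀ b μ, ∀ u ∈ ball (0 : E) R, ∀ x a', ∑ b', ‖Wpl b μ u x a' b'‖ ≤ P.eps * β)
    (hWml : ∀ b μ, ∀ u ∈ ball (0 : E) R, ∀ x a', ∑ b', ‖Wml b μ u x a' b'‖ ≤ P.eps * β)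
    (hPUloc : ∀ b u (p q : Site P 0 × F), PUl b u p q ≠ 0 → blk P P.K p.1 = blk P P.K q.1)
    (hosc : ∀ b x x', blk P P.K x = blk P P.K x' → |h b x - h b x'| ≤ ω)
    (hPUrow : ∀ b, ∀ u ∈ ball (0 : E) R, ∀ p, ∑ q, ‖PUl b u p q‖ ≤ π)
    (hθ : (∑ μ : Fin P.d, (1 + P.eps * β) * δ₁ * (covB P δ₀ (Sum.inl μ) + covB P δ₀ (Sum.inr μ))) +
      (P.d : ℝ) * (Λ + δ₁ * β + δ₁ * β) + |B1RG242Torus.α P a P.K| * (ω * π) ≤ θ) :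
    BlockWalkExpansion c₀ (fun q : Site P 0 × F => cubeOf P q.1) (fun q => cubeOf P q.1)
      (fun (_ : TPt dd N' → ℂ) u => ∑ b, fibD (Site P 0) F (gi b) *
        ((wOp (Site P 0) F (h b) * covOp P F (Wpl b) (Wml b) (PUl b) a msq u -
            covOp P F (Wpl b) (Wml b) (PUl b) a msq u * wOp (Site P 0) F (h b)) * (covOp P F (Wpl b) (Wml b) (PUl b) a msq u)⁻¹) *
        fibD (Site P 0) F (fun x => (((h b x : ℝ) : ℂ)) • g b x)) X R ε κ (N * (rg * rg * (θ * Kbar)))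
      (fun (x : Σ b, W b) σ u => fibD (Site P 0) F (gi x.1) *
        ((wOp (Site P 0) F (h x.1) * covOp P F (Wpl x.1) (Wml x.1) (PUl x.1) a msq u -
            covOp P F (Wpl x.1) (Wml x.1) (PUl x.1) a msq u * wOp (Site P 0) F (h x.1)) * T x.1 x.2 σ u) *
        fibD (Site P 0) F (fun y => (((h x.1 y : ℝ) : ℂ)) • g x.1 y)) {x | x.2 ∈ SX x.1} (fun x => rg * rg * (θ * A x.1 x.2))
      (fun x y y' => D x.1 x.2 y y' + pen x.1 y + pen x.1 y') ρ := by
  have hθ0 : 0 ≤ θ := by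
    refine le_trans ?_ hθ
    have hc : ∀ ι, 0 ≤ covB P δ₀ ι := covB_nonneg δ₀
    have hηβ : 0 ≤ 1 + P.eps * β := by have := P.eps_pos; positivity
    refine add_nonneg (add_nonneg (Finset.sum_nonneg fun μ _ => ?_) (by positivity)) (by positivity)
    exact mul_nonneg (mul_nonneg hηβ hδ₁) (add_nonneg (hc _) (hc _))
  -- the left multiplication by the commutator, per cube
  have hleft : ∀ b, BlockWalkExpansion c₀ (fun q : Site P 0 × F => cubeOf P q.1) (fun q => cubeOf P q.1)
      (fun (σ : TPt dd N' → ℂ) u => (wOp (Site P 0) F (h b) * covOp P F (Wpl b) (Wml b) (PUl b) a msq u -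
          covOp P F (Wpl b) (Wml b) (PUl b) a msq u * wOp (Site P 0) F (h b)) *
        (fun (_ : TPt dd N' → ℂ) u => (covOp P F (Wpl b) (Wml b) (PUl b) a msq u)⁻¹) σ u) X R ε κ (θ * Kbar)
      (fun ω σ u => (wOp (Site P 0) F (h b) * covOp P F (Wpl b) (Wml b) (PUl b) a msq u -
          covOp P F (Wpl b) (Wml b) (PUl b) a msq u * wOp (Site P 0) F (h b)) * T b ω σ u) (SX b) (fun ω => θ * A b ω) (D b) ρ := by
    intro b
    refine (hG b).leftMul hθ0 (fun i k => ?_) (fun ω σ hσ u hu y y' => ?_)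
    · have e : (fun u => (wOp (Site P 0) F (h b) * covOp P F (Wpl b) (Wml b) (PUl b) a msq u -
          covOp P F (Wpl b) (Wml b) (PUl b) a msq u * wOp (Site P 0) F (h b)) i k)
          = fun u => (((h b i.1 - h b k.1 : ℝ)) : ℂ) * covOp P F (Wpl b) (Wml b) (PUl b) a msq u i k :=
        funext fun u => wOp_commutator_apply _ _ i k
      rw [e]; exact (hAhol b i k).const_mul _
    · refine (blockNorm_commutator_covOp_mul_le P F (Wpl b) (Wml b) (PUl b) a msq (h b) u hδ₁ hΛ hβ hω hπ (hdp b) (hdm b)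
        (hlap b) (fun μ => hWpl b μ u hu) (fun μ => hWml b μ u hu) (hPUloc b)
        (fun p q hne => hosc b p.1 q.1 (hPUloc b u p q hne)) (hPUrow b u hu) (T b ω σ u) ((hG b).majB ω σ hσ u hu)
        (fun ι => hGD b ι ω σ hσ u hu) y y').trans ?_
      exact mul_le_mul_of_nonneg_right hθ (mul_nonneg ((hG b).A_nonneg ω) (Real.exp_nonneg _))
  -- the conjugation by `fibD g⁻¹` and `fibD(hg)`
  have hconj : ∀ b, BlockWalkExpansion c₀ (fun q : Site P 0 × F => cubeOf P q.1) (fun q => cubeOf P q.1)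
      (fun (σ : TPt dd N' → ℂ) u => fibD (Site P 0) F (gi b) *
        (fun (σ : TPt dd N' → ℂ) u => (wOp (Site P 0) F (h b) * covOp P F (Wpl b) (Wml b) (PUl b) a msq u -
            covOp P F (Wpl b) (Wml b) (PUl b) a msq u * wOp (Site P 0) F (h b)) *
          (fun (_ : TPt dd N' → ℂ) u => (covOp P F (Wpl b) (Wml b) (PUl b) a msq u)⁻¹) σ u) σ u *
        fibD (Site P 0) F (fun x => (((h b x : ℝ) : ℂ)) • g b x)) X R ε κ (rg * rg * (θ * Kbar))
      (fun ω σ u => fibD (Site P 0) F (gi b) * ((wOp (Site P 0) F (h b) * covOp P F (Wpl b) (Wml b) (PUl b) a msq u -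
          covOp P F (Wpl b) (Wml b) (PUl b) a msq u * wOp (Site P 0) F (h b)) * T b ω σ u) *
        fibD (Site P 0) F (fun x => (((h b x : ℝ) : ℂ)) • g b x)) (SX b) (fun ω => rg * rg * (θ * A b ω)) (D b) ρ := fun b =>
    (hleft b).conj _ _ (fun i j hne => fibD_offCube P F _ i j hne) (fun i j hne => fibD_offCube P F _ i j hne) hrg hrg
      (fun p => by simpa using rowSum_fibD_smul_le F (fun _ => (1 : ℝ)) (gi b) (fun _ => by simp) (hgir b) p)
      (rowSum_fibD_smul_le F (h b) (g b) (hh1 b) (hgr b))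
  -- rows of the commutator vanish on the cubes where `pen ≠ 0`
  have hVrow : ∀ b u x, pen b (cubeOf P x) ≠ 0 → ∀ a' q, (wOp (Site P 0) F (h b) * covOp P F (Wpl b) (Wml b) (PUl b) a msq u -
      covOp P F (Wpl b) (Wml b) (PUl b) a msq u * wOp (Site P 0) F (h b)) (x, a') q = 0 := fun b u x hp a' q =>
    commutator_row_eq_zero P F (Wpl b) (Wml b) (PUl b) a msq (hPUloc b) (h b) u (x, a') (fun μ => (hpenN b x μ hp).1)
      (fun μ => (hpenN b x μ hp).2) (fun x' hx' => hpenh b x' (by rw [cubeOf_eq_iff.2 hx']; exact hp)) q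
  refine blockWalkExpansion_sum_localized hconj hερ (by positivity) hpen0 (fun b ω σ _ u _ y y' hne => ?_) hN
  constructor
  · by_contra hp
    refine hne (blockNorm_eq_zero_of_rows _ _ _ (fun i hi j => ?_) y')
    have hx : pen b (cubeOf P i.1) ≠ 0 := by rw [show cubeOf P i.1 = y from hi]; exact hp
    have e : i = (i.1, i.2) := rfl
    rw [e]
    exact conj_rows_vanish (gi b) _ _ _ i.1 (hVrow b u i.1 hx) i.2 j
  · by_contra hp
    refine hne (blockNorm_eq_zero_of_cols _ _ _ (fun j hj i => ?_) y)
    have hx : pen b (cubeOf P j.1) ≠ 0 := by rw [show cubeOf P j.1 = y' from hj]; exact hp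
    have hz : (fun y => (((h b y : ℝ) : ℂ)) • g b y) j.1 = 0 := by
      simp only [hpenh b j.1 hx, Complex.ofReal_zero, zero_smul]
    exact mul_fibD_apply_of_zero F _ _ j hz i

end Step

/-! ## §4. THE END: (3.87)–(3.90) glued from whole-torus seeds in per-cube gauges -/

section End
variable {c₀ : B13.Consts} {X : Finset (UT (Nv P P.K))} {R ε κ Kbar ρ δ₀ μr cμ : ℝ}
variable {W : B → Type} {T : (b : B) → W b → (TPt dd N' → ℂ) → E → Matrix (Site P 0 × F) (Site P 0 × F) ℂ}
variable {SX : (b : B) → Set (W b)} {A : (b : B) → W b → ℝ} {D : (b : B) → W b → UT (Nv P P.K) → UT (Nv P P.K) → ℝ}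
variable {pen : B → UT (Nv P P.K) → ℝ} {N rg : ℝ}
variable {Wp Wm : Fin P.d → E → Site P 0 → Matrix F F ℂ} {Ug Ugi : E → Site P 0 → Matrix F F ℂ}
variable {Wpl Wml : B → Fin P.d → E → Site P 0 → Matrix F F ℂ} {Ugl Ugil : B → E → Site P 0 → Matrix F F ℂ}
variable {a msq : ℝ} {g gi : B → Site P 0 → Matrix F F ℂ} {h : B → Site P 0 → ℝ} {S : B → Set (Site P 0)}
variable {δ₁ Λ β ω π θ : ℝ}

/-- **ROAD (c′) END, VALUE LEVEL: `(Δ_W + m² + a_KP_K(U))⁻¹` IS A BLOCK WALK EXPANSION GLUED BY (3.87)–(3.90) FROM WHOLE-TORUS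
LOCAL INVERSES IN PER-CUBE GAUGES.**  Data at scale `(ε, κ, K̄, ρ)`: for each cube `b` of a finite index, local defects `W̃^±_b`,
local block-contour transporters `Ũ_b(Γ)`, the one-scale operator `A′_b = Δ_{W̃_b} + m² + a_KP_K(Ũ_b)` (entrywise holomorphic,
invertible on the ball) whose INVERSE is block-walk-expanded with relative `covDop` letters `covB δ₀` and dominating distances (66 ∕
126 supply this for the χ-truncated gauge-fixed fields); sitewise-invertible gauges `(g_b, g_b⁻¹)` with fibre row sums `≤ r_g`; a
partition `Σ_b h_b² = 1`, `|h_b| ≤ 1`, `supp h_b ⊆ S_b`, difference letters `δ₁, Λ`, block oscillation `ω`, `h_b` and its lattice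
neighbours vanishing on the cubes where the penalty `pen_b ≥ 0` is non-zero, overlap letter `Σ_b e^{−(ρ−ε)pen_b(a)} ≤ N`; windows
`Σ‖W̃^±_b(u,x)_{ab′}‖ ≤ ηβ`, averaging rows `≤ π`; 124's AGREEMENT of the local data with the gauged data of `(W^±, U(Γ))` on what
the columns over `S_b` read; the unit `1 − R(u)` (as in 56); cube row sum `(μ, c_μ)` with `2μ ≤ ε`, `2μ ≤ κ`, `κ + μ ≤ ρ − ε`; and
the MARGIN `c_μ(c_μ·1·(1·N r_g²θK̄)c_μ)c_μ < 1`, `θ ≥ Σ_μ(1 + ηβ)δ₁(covB_{inl μ} + covB_{inr μ}) + d(Λ + 2δ₁β) + |a_K|ωπ` («M large»: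
`δ₁, Λ, ω = O(M⁻¹)`).  THEN `u ↦ (Δ_W(u) + m² + a_KP_K(U)(u))⁻¹` is a block walk expansion at `(ε − 2μ, κ − 2μ, ρ − 2μ)` with constant
`c_μ·N r_g²K̄·(1·(1 − q)⁻¹)·c_μ` and dominating distances — NO sub-domain, NO Dirichlet propagator, NO compression; no constant depends
on `K` or the volume. [cite: Balaban1985BackgroundPropagators, (3.87)–(3.90) p.409, p.410, Cor. 3.5 p.407, Cor. 3.6 p.408, (3.35) p.396, (3.107)–(3.108) p.416; Balaban1988RG2Cluster, (1.11) p.5, p.13, p.15] -/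
theorem blockWalkExpansion_covOp_glued
    (hG : ∀ b, BlockWalkExpansion c₀ (fun q : Site P 0 × F => cubeOf P q.1) (fun q => cubeOf P q.1)
      (fun (_ : TPt dd N' → ℂ) u => (covOp P F (Wpl b) (Wml b) (PU P F (Ugl b) (Ugil b)) a msq u)⁻¹) X R ε κ Kbar (T b) (SX b)
      (A b) (D b) ρ)
    (hGD : ∀ b ι ω (σ : TPt dd N' → ℂ), (∀ j, ‖σ j‖ ≤ Real.exp c₀.κ₁) → ∀ u ∈ ball (0 : E) R, ∀ y y',
      blockNorm (fun q : Site P 0 × F => cubeOf P q.1) (fun q => cubeOf P q.1) (covDop P F ι * T b ω σ u) y y' ≤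
        covB P δ₀ ι * (A b ω * Real.exp (-(ρ * D b ω y y'))))
    (hGdom : ∀ b ω, DomBy (toB6 (torusGeom (Nv P P.K) 0 0 0) 0 True) (D b ω))
    (hερ : ε ≤ ρ) (hKbar : 0 ≤ Kbar) (hrg : 0 ≤ rg)
    (hgr : ∀ b x a', ∑ b', ‖g b x a' b'‖ ≤ rg) (hgir : ∀ b x a', ∑ b', ‖gi b x a' b'‖ ≤ rg) (hh1 : ∀ b x, |h b x| ≤ 1)
    (hpen0 : ∀ b y, 0 ≤ pen b y) (hpenh : ∀ b x, pen b (cubeOf P x) ≠ 0 → h b x = 0)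
    (hpenN : ∀ b x μ, pen b (cubeOf P x) ≠ 0 → h b (Site.shift x μ) = 0 ∧ h b (Site.unshift x μ) = 0)
    (hN : ∀ a, ∑ b, Real.exp (-((ρ - ε) * pen b a)) ≤ N)
    (hAhol : ∀ b p q, DifferentiableOn ℂ (fun u => covOp P F (Wpl b) (Wml b) (PU P F (Ugl b) (Ugil b)) a msq u p q) (ball (0 : E) R))
    (hδ₁ : 0 ≤ δ₁) (hΛ : 0 ≤ Λ) (hβ : 0 ≤ β) (hω : 0 ≤ ω) (hπ : 0 ≤ π)
    (hdp : ∀ b μ y, |P.eps⁻¹ * (h b (Site.shift y μ) - h b y)| ≤ δ₁)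
    (hdm : ∀ b μ y, |P.eps⁻¹ * (h b y - h b (Site.unshift y μ))| ≤ δ₁)
    (hlap : ∀ b μ y, |(P.eps⁻¹) ^ 2 * (h b (Site.shift y μ) - 2 * h b y + h b (Site.unshift y μ))| ≤ Λ)
    (hWpl : ∀ b μ, ∀ u ∈ ball (0 : E) R, ∀ x a', ∑ b', ‖Wpl b μ u x a' b'‖ ≤ P.eps * β)
    (hWml : ∀ b μ, ∀ u ∈ ball (0 : E) R, ∀ x a', ∑ b', ‖Wml b μ u x a' b'‖ ≤ P.eps * β)
    (hosc : ∀ b x x', blk P P.K x = blk P P.K x' → |h b x - h b x'| ≤ ω)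
    (hPUrow : ∀ b, ∀ u ∈ ball (0 : E) R, ∀ p, ∑ q, ‖PU P F (Ugl b) (Ugil b) u p q‖ ≤ π)
    (hθ : (∑ μ : Fin P.d, (1 + P.eps * β) * δ₁ * (covB P δ₀ (Sum.inl μ) + covB P δ₀ (Sum.inr μ))) +
      (P.d : ℝ) * (Λ + δ₁ * β + δ₁ * β) + |B1RG242Torus.α P a P.K| * (ω * π) ≤ θ)
    -- the resummation (124): gauges, partition of unity, agreement of the local data with the gauged field, local invertibility
    (hg : ∀ b x, g b x * gi b x = 1) (hgi : ∀ b x, gi b x * g b x = 1) (hhS : ∀ b y, y ∉ S b → h b y = 0)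
    (hsum : ∀ x, ∑ b, h b x ^ 2 = 1)
    (hp : ∀ u ∈ ball (0 : E) R, ∀ b μ y, y ∈ S b → Wpl b μ u (Site.unshift y μ) =
      g b (Site.unshift y μ) * (1 + Wp μ u (Site.unshift y μ)) * gi b (Site.shift (Site.unshift y μ) μ) - 1)
    (hm : ∀ u ∈ ball (0 : E) R, ∀ b μ y, y ∈ S b → Wml b μ u (Site.shift y μ) =
      g b (Site.shift y μ) * (1 + Wm μ u (Site.shift y μ)) * gi b (Site.unshift (Site.shift y μ) μ) - 1)
    (hUgi : ∀ u ∈ ball (0 : E) R, ∀ b x y, y ∈ S b → blk P P.K x = blk P P.K y → Ugil b u x = g b x * Ugi u x)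
    (hUg : ∀ u ∈ ball (0 : E) R, ∀ b y, y ∈ S b → Ugl b u y = Ug u y * gi b y)
    (hA' : ∀ b, ∀ u ∈ ball (0 : E) R, IsUnit (covOp P F (Wpl b) (Wml b) (PU P F (Ugl b) (Ugil b)) a msq u).det)
    -- the unit of (3.90)
    (hunit : ∀ u ∈ ball (0 : E) R, IsUnit (1 - ∑ b, fibD (Site P 0) F (gi b) *
        ((wOp (Site P 0) F (h b) * covOp P F (Wpl b) (Wml b) (PU P F (Ugl b) (Ugil b)) a msq u -
            covOp P F (Wpl b) (Wml b) (PU P F (Ugl b) (Ugil b)) a msq u * wOp (Site P 0) F (h b)) *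
          (covOp P F (Wpl b) (Wml b) (PU P F (Ugl b) (Ugil b)) a msq u)⁻¹) *
        fibD (Site P 0) F (fun x => (((h b x : ℝ) : ℂ)) • g b x)).det)
    -- rates, cube row sum, margin (55)
    (hμ : 0 ≤ μr) (hμε : 2 * μr ≤ ε) (hμκ : 2 * μr ≤ κ) (hwin : κ + μr ≤ ρ - ε) (hcμ : 0 ≤ cμ)
    (hrow : RowSum (toB6 (torusGeom (Nv P P.K) 0 0 0) 0 True) μr cμ)
    (hq : cμ * (cμ * 1 * (1 * (N * (rg * rg * (θ * Kbar)))) * cμ) * cμ < 1) :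
    ∃ (W' : Type) (T' : W' → (TPt dd N' → ℂ) → E → Matrix (Site P 0 × F) (Site P 0 × F) ℂ) (SX' : Set W') (A' : W' → ℝ)
      (D' : W' → UT (Nv P P.K) → UT (Nv P P.K) → ℝ),
      BlockWalkExpansion c₀ (fun q : Site P 0 × F => cubeOf P q.1) (fun q => cubeOf P q.1)
        (fun (_ : TPt dd N' → ℂ) u => (covOp P F Wp Wm (PU P F Ug Ugi) a msq u)⁻¹) X R (ε - 2 * μr) (κ - 2 * μr)
        (cμ * (N * (rg * rg * Kbar)) * (1 * (1 - cμ * (cμ * 1 * (1 * (N * (rg * rg * (θ * Kbar)))) * cμ) * cμ)⁻¹) * cμ)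
        T' SX' A' D' (ρ - 2 * μr) ∧
      ∀ ω, DomBy (toB6 (torusGeom (Nv P P.K) 0 0 0) 0 True) (D' ω) := by
  have hθ0 : 0 ≤ θ := by
    refine le_trans ?_ hθ
    have hc : ∀ ι, 0 ≤ covB P δ₀ ι := covB_nonneg δ₀
    have hηβ : 0 ≤ 1 + P.eps * β := by have := P.eps_pos; positivity
    refine add_nonneg (add_nonneg (Finset.sum_nonneg fun μ _ => ?_) (by positivity)) (by positivity)
    exact mul_nonneg (mul_nonneg hηβ hδ₁) (add_nonneg (hc _) (hc _))
  have hN0 : 0 ≤ N := le_trans (Finset.sum_nonneg fun b _ => (Real.exp_pos _).le) (hN (cubeOf P default))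
  have hS := seed_blockWalkExpansion
    (Aloc := fun b u => covOp P F (Wpl b) (Wml b) (PU P F (Ugl b) (Ugil b)) a msq u) hG hερ hKbar hrg hgr hgir hh1 hpen0 hpenh hN
  have hR := step_blockWalkExpansion (PUl := fun b => PU P F (Ugl b) (Ugil b)) hG hGD hερ hKbar hrg hgr hgir hh1 hpen0 hpenh hpenN hN
    hAhol hδ₁ hΛ hβ hω hπ hdp hdm hlap hWpl hWml (fun b u p q hne => PU_blockLocal P F (Ugl b) (Ugil b) u p q hne) hosc hPUrow hθ
  have hdomS := domBy_sum_localized (W := W) (D := D) hGdom hpen0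
  obtain ⟨W', T', SX', A', D', hBWE, -, hdom'⟩ := blockWalkExpansion_perturb (ι := Empty) (Dop := fun e : Empty => e.elim)
    (B := fun e : Empty => e.elim) (cub := fun q : Site P 0 × F => cubeOf P q.1) hS hdomS (fun e : Empty => e.elim)
    (fun e : Empty => e.elim) hR hdomS hμ hμε hμκ hwin (by positivity) (by positivity) hcμ hrow hq
  refine ⟨W', T', SX', A', D', hBWE.congrK fun σ u _ hu => ?_, hdom'⟩
  exact inv_eq_of_resummation _ _ _ (covOp_resummation_shapes P F Wp Wm Ug Ugi a msq g gi Wpl Wml Ugl Ugil S h hg hgi hhS hsum u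
    (hp u hu) (hm u hu) (hUgi u hu) (hUg u hu) (fun b => hA' b u hu)) (hunit u hu)

end End

end Summit.QuantumFields.BalabanUV.Gaps.D4WalkBlockTruncatedSeeds

end
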